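import Literature.Geometry.Lorentzian.KerrRadiusPseudoconvexityKS
import HarnessLib

/-!
# `T`-conditional null pseudo-convexity of the Kerr cylinders at every radius beyond the horizon

(family `gr`; namespace `Literature.Geometry.Lorentzian.Kerr`; sequel to
`KerrRadiusPseudoconvexity.lean` / `KerrRadiusPseudoconvexityKS.lean`.)

Ionescu–Klainerman (Invent. Math. 175 (2009), §3.1) replace Hörmander's pseudo-convexity of a
function `h` by the **`T`-conditional pseudo-convexity condition**
(HoCond2): `T(h) = 0` and `D²h(X, X) < 0` whenever `g(X, X) = g(X, ∇h) = g(T, X) = 0`, `X ≠ 0`,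
`T` the stationary Killing field; unique continuation for `T`-invariant tensors (their
Mars–Simon tensor `𝒮`, `ℒ_T 𝒮 = 0`) across the level sets of `h` then needs only this weaker
inequality, which — they remark — "can be verified in all Kerr spaces `a ∈ [0, m)` for the simple
function `h = r`". This file is the kernel-checked form of that remark for the tree's Kerr–Schild
Kerr family, at EVERY point beyond the outer horizon and for every `|a| ≤ M`:

* `Kerr.deriv_nullRadialPotential_neg_of_energy_eq_zero` — the algebraic heart: a Θ-admissible,
  non-trivial set of null constants with ZERO Killing energy `E = 0` has
  `R′(c) = −2(c − M)(Q + L²) < 0` at every `c > M` (no root hypothesis, no spin bound): for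
  `E = 0`, Θ-admissibility gives `Q ≥ 0` (`NullThetaAdmissible.carter_nonneg`);
* `Kerr.Ingoing.hessR_neg_of_energy_eq_zero` — in the ingoing chart, off the axis, at every
  point with `r > r₊`: a non-zero vector that is null, tangent to `{r = c}` and orthogonal to
  `∂_{t*}` has `Hess r(w, w) < 0` (`2Σ² Hess r(w,w) = R′`, `KerrRadiusPseudoconvexity.lean`);
* `Kerr.hessAt_radius_neg_of_bilin_basisVector_zero` — the same in Kerr–Schild Cartesian
  coordinates at EVERY point with `r > r₊`, axis included (on the axis a non-zero null tangent
  vector has `E ≠ 0`, `Kerr.ksEnergy_ne_zero_of_axis`, so the condition is vacuous there);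
* the first half of (HoCond2), `T(r) = 0`, is the tree's `Kerr.fderiv_radius_basisVector_zero`
  (`KerrRpBulk.lean`).

So every cylinder `{r = c}`, `c > r₊`, is `T`-conditionally pseudo-convex towards `{r < c}` —
across the photon shell `[r_ph⁺, r_ph⁻]` included, where plain pseudo-convexity fails from both
sides (`KerrPhotonShellNotPseudoconvex.lean`): a trapped null geodesic never has zero energy.
Outside the ergoregion the condition is empty (no non-zero null vector is orthogonal to the
timelike `∂_{t*}`); its content is in the ergoregion, where `Q + L² = a²L²/Δ > 0`.

## References

* A. D. Ionescu, S. Klainerman, *On the uniqueness of smooth, stationary black holes in vacuum*,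
  Invent. Math. 175 (2009) 35–102, §3.1, condition (HoCond2) and the remark following it.
* S. Alexakis, A. D. Ionescu, S. Klainerman, *Uniqueness of smooth stationary black holes in
  vacuum: small perturbations of the Kerr spaces*, Comm. Math. Phys. 299 (2010) 89–127 (the
  perturbative use of the same condition).
* B. Carter, Comm. Math. Phys. 10 (1968) 280–310, §4 (the separated null geodesic equations).
-/

noncomputable section

set_option maxSynthPendingDepth 3

open Set Function Module Real
open scoped Topology ContDiff
open Literature.Geometry.Lorentzian.MetricCoord

namespace Literature.Geometry.Lorentzian

namespace Kerr

variable {M a : ℝ}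

/-! ### The sign of `R′` at zero energy -/

/-- **Zero-energy null constants are apocentral at every radius `c > M`.** For Θ-admissible null
constants `(E, L, Q) = (0, L, Q) ≠ 0` (zero Killing energy) the null radial Carter potential
`R(r) = a²L² − Δ(r)(Q + L²)` has `R′(c) = −2(c − M)(Q + L²) < 0` for every `c > M`:
Θ-admissibility at `E = 0` forces `Q ≥ 0`, and `(L, Q) ≠ (0, 0)`. No root condition and no bound
on the spin are needed. Ionescu–Klainerman, Invent. Math. 175 (2009), §3.1 (the inequality in
(HoCond2) for `h = r`). [cite: IonescuKlainerman2008, §3.1] -/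
theorem deriv_nullRadialPotential_neg_of_energy_eq_zero {L Q c : ℝ} (hc : M < c)
    (hadm : NullThetaAdmissible a 0 L Q) (hne : L ≠ 0 ∨ Q ≠ 0) :
    deriv (nullRadialPotential M a 0 L Q) c < 0 := by
  have hQ : 0 ≤ Q := hadm.carter_nonneg (by nlinarith [sq_nonneg L])
  have hK : 0 < Q + L ^ 2 := by
    rcases hne with h | h
    · have : 0 < L ^ 2 := by positivity
      linarith
    · have : 0 < Q := lt_of_le_of_ne hQ (Ne.symm h)
      nlinarith [sq_nonneg L]
  rw [deriv_nullRadialPotential]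
  have e : 4 * (0 : ℝ) * c * (0 * (c ^ 2 + a ^ 2) - a * L) -
      (2 * c - 2 * M) * (Q + (L - a * 0) ^ 2) = -(2 * (c - M) * (Q + L ^ 2)) := by
    ring
  rw [e, neg_lt_zero]
  have hcM : 0 < c - M := sub_pos.2 hc
  positivity

namespace Ingoing

variable {u : E4}

/-- **`T`-conditional inward bending of every cylinder beyond the horizon (ingoing chart, off the
axis).** For `0 < M`, `|a| ≤ M`, at every chart point with `r > r₊` and `μ² < 1`, every non-zero
vector `w` that is NULL, TANGENT to `{r = const}` (`wʳ = 0`) and ORTHOGONAL TO THE STATIONARY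
KILLING FIELD (`E = −g(∂_{t*}, w) = 0`) has `hessR(u, w) = Hess_g r(w, w) < 0`. Proof:
`2Σ² Hess r(w,w) = R′(r; 0, L, Q)` (`two_mul_sq_sigma_mul_hessR_sub_deriv` on the null cone), the
constants are Θ-admissible (`nullThetaAdmissible_constants`) and non-trivial
(`constants_ne_zero`), and `Kerr.deriv_nullRadialPotential_neg_of_energy_eq_zero`. This is the
inequality of Ionescu–Klainerman's condition (HoCond2) for `h = r`, at every radius — the photon
shell included. [cite: IonescuKlainerman2008, §3.1] -/
theorem hessR_neg_of_energy_eq_zero (hM : 0 < M) (ha : |a| ≤ M) (hr : rPlus M a < u 1)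
    (hμ : u 2 ^ 2 < 1) {w : E4} (hw : w ≠ 0) (hnull : bilin M a u w w = 0) (htan : w 1 = 0)
    (hE : energy M a u w = 0) : hessR M a u w < 0 := by
  have hu : u ∈ regularSet a := mem_regularSet_of_rPlus_lt hM hr hμ
  have hΔ : 0 < u 1 ^ 2 - 2 * M * u 1 + a ^ 2 := delta_pos_of_rPlus_lt ha hr
  have hMr : M < u 1 := by
    have : M ≤ rPlus M a := by
      unfold rPlus; linarith [Real.sqrt_nonneg (M ^ 2 - a ^ 2)]
    linarith
  have hadm : NullThetaAdmissible a 0 (angMom M a u w) (carterQ M a u w) := by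
    have h := nullThetaAdmissible_constants (M := M) (a := a) hμ w
    rwa [hE] at h
  have hne : angMom M a u w ≠ 0 ∨ carterQ M a u w ≠ 0 := by
    have h := constants_ne_zero hu hΔ.ne' hw hnull
    rw [hE] at h
    rcases h with h | h
    · exact absurd rfl h
    · exact h
  have hd : deriv (nullRadialPotential M a 0 (angMom M a u w) (carterQ M a u w)) (u 1) < 0 :=
    deriv_nullRadialPotential_neg_of_energy_eq_zero hMr hadm hne
  have hII := two_mul_sq_sigma_mul_hessR_sub_deriv (M := M) hu htan
  rw [hnull, mul_zero, hE] at hII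
  have hS : 0 < sigma a u ^ 2 := by positivity [hu.1]
  have : 2 * sigma a u ^ 2 * hessR M a u w < 0 := by linarith
  nlinarith

end Ingoing

/-! ### Kerr–Schild coordinates, every point -/

/-- **`T`-conditional inward bending of EVERY Kerr cylinder beyond the horizon (Kerr–Schild
coordinates, axis included).** For `0 < M`, `|a| ≤ M`, at every point `z` of Kerr–Schild coordinate
space with `r(z) > r₊`, every non-zero vector `w` which is null for `g_{M,a}`, tangent to the
cylinder `{r = r(z)}` (`dr_z(w) = 0`) and orthogonal to the stationary Killing field
`∂_{t*} = E4.basisVector 0` (`g_z(∂_{t*}, w) = 0`) has `Hess r(w, w) < 0`: the cylinder is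
`T`-conditionally strongly pseudo-convex towards `{r < c}` in the sense of Ionescu–Klainerman,
Invent. Math. 175 (2009), §3.1, condition (HoCond2), at EVERY radius `c > r₊` — in particular
across the photon shell `[r_ph⁺, r_ph⁻]`, where unconditional pseudo-convexity fails from both
sides. Off the axis this is `Kerr.Ingoing.hessR_neg_of_energy_eq_zero` transported through the
chart; on the axis a non-zero null tangent vector has non-zero energy
(`Kerr.ksEnergy_ne_zero_of_axis`), so the hypothesis is void there.
[cite: IonescuKlainerman2008, §3.1] -/
theorem hessAt_radius_neg_of_bilin_basisVector_zero (hM : 0 < M) (ha : |a| ≤ M) {z : E4}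
    (hz : rPlus M a < radius a z) {w : E4} (hw : w ≠ 0) (hnull : Kerr.bilin M a z w w = 0)
    (htan : fderiv ℝ (radius a) z w = 0) (horth : Kerr.bilin M a z (E4.basisVector 0) w = 0) :
    hessAt (Kerr.bilin M a) (radius a) z w w < 0 := by
  have hrp : 0 < rPlus M a := by
    have : M ≤ rPlus M a := by unfold rPlus; linarith [Real.sqrt_nonneg (M ^ 2 - a ^ 2)]
    linarith
  have hr : 0 < radius a z := hrp.trans hz
  by_cases hoff : z 1 ≠ 0 ∨ z 2 ≠ 0
  · have hzr : z ∈ region a 0 := by rw [mem_region, max_self]; exact hr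
    obtain ⟨u, hu, rfl⟩ := Ingoing.exists_chartFun_eq (a := a) (r₀ := 0) hzr hoff
    obtain ⟨v, rfl⟩ := Ingoing.jac_surjective (a := a) hu w
    have hu1 : u 1 = radius a (Ingoing.chartFun a 0 u) := by
      rw [Ingoing.radius_chartFun, Ingoing.radialParam_of_lt hu.1]
    have hv : v ≠ 0 := by
      rintro rfl; exact hw (map_zero _)
    have hnull' : Ingoing.bilin M a u v v = 0 := by
      rw [← Ingoing.kerrBilin_jac hu]; exact hnull
    have htan' : v 1 = 0 := by
      rw [← Ingoing.fderiv_radius_chartFun_jac hu v]; exact htan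
    have hE' : Ingoing.energy M a u v = 0 := by
      rw [← Ingoing.ksEnergy_chartFun_jac hu v]
      unfold ksEnergy
      rw [horth, neg_zero]
    have hμ : u 2 ^ 2 < 1 := by
      have h := hu.2; nlinarith [h.1, h.2]
    rw [Ingoing.hessAt_bilin_radius_chartFun_self hu]
    exact Ingoing.hessR_neg_of_energy_eq_zero hM ha (by rw [hu1]; exact hz) hμ hv hnull' htan' hE'
  · push Not at hoff
    obtain ⟨h1, h2⟩ := hoff
    have hE : ksEnergy M a z w = 0 := by
      unfold ksEnergy
      rw [horth, neg_zero]
    exact absurd hE (ksEnergy_ne_zero_of_axis ha hr hz h1 h2 hw hnull htan)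

/-- The same statement with the energy written as `Kerr.ksEnergy M a z w = 0`.
[cite: IonescuKlainerman2008, §3.1] -/
theorem hessAt_radius_neg_of_ksEnergy_eq_zero (hM : 0 < M) (ha : |a| ≤ M) {z : E4}
    (hz : rPlus M a < radius a z) {w : E4} (hw : w ≠ 0) (hnull : Kerr.bilin M a z w w = 0)
    (htan : fderiv ℝ (radius a) z w = 0) (hE : ksEnergy M a z w = 0) :
    hessAt (Kerr.bilin M a) (radius a) z w w < 0 := by
  refine hessAt_radius_neg_of_bilin_basisVector_zero hM ha hz hw hnull htan ?_
  unfold ksEnergy at hE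
  exact neg_eq_zero.1 hE

end Kerr

end Literature.Geometry.Lorentzian

end
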